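import Literature.Computability.Complexity.OneInThreeSATMachine
import Literature.Computability.Complexity.OneInThreeSATRename
import HarnessLib

/-!
# The reduction `1-IN-3-SAT → 2D-X-RAY` on codes, I: reading clause codes, the first-occurrence
# fold, the instance test

First of the machine files discharging `GGP1999_circuitBoard : ONEIN3SAT ≤ₚ TWODXRAY`
(`OneInThreeSAT.lean`) by the ladder complex (`OneInThreeSATLadder.lean`, correctness
`xrayOf_mem_twoDXRaySet_iff` in `OneInThreeSATRename.lean`). Everything is brick algebra over
the tree's `FP` toolkit (`BrickAlgebra`, `ListFoldBricks`, `FoldBricks`, `StringEquality`); no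
machine is written by hand. On a CNF code `w = ⟨1ᵐ, ⟨a₀, … ⟨a_{m-1}, ε⟩…⟩⟩` (`encodingCNF`,
`listBool_encode_eq_encList`) with clause codes `a_c = ⟨1ᵏ, ⟨u₀, ⟨u₁, …⟩⟩⟩` and literal codes
`u_j = ⟨bin v, [b]⟩` (`encodeLit_eq`):

* accessors `litItemF j`, `varF j`, `pltF j` (literal `j` of a clause code, its numeral, its
  polarity bit) with their values on genuine codes;
* **the first-occurrence fold** `firstOccF ⟨w, x⟩ = 1^{first occurrence of the numeral x}`: a
  `foldFn` over the clause codes whose step scans the three literal numerals of a clause with a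
  latch (`occStep`, model `occUpd`/`occClause`), value `firstOccF_encode :
  firstOccF ⟨encode φ, bin v⟩ = 1^{firstOcc φ v}` for clause lists with three literals per clause
  (`OneInThree.firstOcc`, `OneInThreeSATRename.lean`), membership in `FP` (`FoldGrowth 15`);
* **the instance test** `threeOKF` (`allFn` of "header `1³` and three pairwise distinct literal
  codes"), value `threeOKF_encode : threeOKF (encode φ) = [φ.IsThreeLiteralClauses]`, and the
  guard `goodF = isCanonFn ∧ threeOKF`;
* **the complementary-pair test** `hasPairF` on a clause code, value `hasPairF_encode :
  hasPairF (encode C) = [HasPair C]` for clauses of three distinct literals.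

## References

* [AroraBarak2009] S. Arora, B. Barak, *Computational Complexity*, CUP 2009, §1.3 (polynomial
  time is closed under composition and bounded loops), §0.1 (codes of lists).
* [GardnerGritzmannPrangenberg1999] R. J. Gardner, P. Gritzmann, D. Prangenberg, Discrete Math.
  202 (1999) 45–71, Lemma 3.4 ("Since the transformation runs in polynomial time, the proof is
  complete").
-/

noncomputable section

namespace Literature.Computability.Complexity

namespace OneInThree

open _root_.Computability Polynomial Brick Ladder3
open scoped Notation

/-! ### Fields of a coded list -/

/-- Field `j` of a coded list is its item `j` (`ε` past the end). Twin of
`FregeTransl.nthF_encList` (`MetaComplexity/FregeTranslation.lean`, which sits on top of the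
proof-complexity development and is not importable into the `Complexity` toolkit) — a librarian
refactor should hoist one copy next to `encList`. [folklore] -/
theorem nthF_encList : ∀ (j : ℕ) (l : List (List Bool)), nthF j (encList l) = l.getD j []
  | 0, [] => by simp [nthF, fstF, boolUnpair]
  | 0, a :: l => by rw [encList_cons, nthF_zero_boolPair]; rfl
  | j + 1, [] => by
    rw [encList_nil]
    show nthF j (sndF []) = [].getD (j + 1) []
    rw [HashBricks.sndF_nil, ← encList_nil, nthF_encList j []]
    rfl
  | j + 1, a :: l => by rw [encList_cons, nthF_succ_boolPair, nthF_encList j l]; rfl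

/-- The code of a CNF: unary length and the list code of the clause codes. [folklore] -/
theorem encodeCNF_eq (φ : CNF ℕ) :
    encodingCNF.encode φ = boolPair (ones φ.length) (encList (φ.map encodingClause.encode)) := by
  rw [show encodingCNF = encodingClause.listBool from rfl, listBool_encode_eq_encList,
    unaryEncodeNat_eq_ones']

/-- The code of a clause: unary length and the list code of the literal codes. [folklore] -/
theorem encodeClause_eq (C : Clause ℕ) :
    encodingClause.encode C = boolPair (ones C.length) (encList (C.map encodingLiteral.encode)) := by
  rw [show encodingClause = encodingLiteral.listBool from rfl, listBool_encode_eq_encList,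
    unaryEncodeNat_eq_ones']

/-- The code of a literal: `⟨bin v, [b]⟩` (`rfl`; twin of `encodingLiteral_encode_eq` of
`ClauseTableChecker.lean` and `CNFIsing.encodingLiteral_encode`, both downstream of heavier
imports). [folklore] -/
theorem encodeLit_eq (l : Literal ℕ) : encodingLiteral.encode l = boolPair (encodeNat l.1) [l.2] := rfl

/-! ### Accessors of a clause code -/

/-- Literal code `j` of a clause code. [folklore] -/
def litItemF (j : ℕ) : List Bool → List Bool := nthF j ∘ sndF

/-- The variable numeral of literal `j` of a clause code. [folklore] -/
def varF (j : ℕ) : List Bool → List Bool := fstF ∘ litItemF j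

/-- The polarity string of literal `j` of a clause code. [folklore] -/
def pltF (j : ℕ) : List Bool → List Bool := sndF ∘ litItemF j

/-- `litItemF j ∈ FP`. [cite: AroraBarak2009, §1.3] -/
theorem litItemF_mem_FP (j : ℕ) : litItemF j ∈ FP := comp_mem_FP (nthF_mem_FP j) sndF_mem_FP

/-- `varF j ∈ FP`. [cite: AroraBarak2009, §1.3] -/
theorem varF_mem_FP (j : ℕ) : varF j ∈ FP := comp_mem_FP fstF_mem_FP (litItemF_mem_FP j)

/-- `pltF j ∈ FP`. [cite: AroraBarak2009, §1.3] -/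
theorem pltF_mem_FP (j : ℕ) : pltF j ∈ FP := comp_mem_FP sndF_mem_FP (litItemF_mem_FP j)

/-- Literal code `j` of a genuine clause code. [folklore] -/
theorem litItemF_encode (C : Clause ℕ) {j : ℕ} (hj : j < C.length) :
    litItemF j (encodingClause.encode C) = encodingLiteral.encode C[j] := by
  rw [litItemF, Function.comp_apply, encodeClause_eq, sndF_boolPair, nthF_encList,
    List.getD_eq_getElem _ _ (by simpa using hj), List.getElem_map]

/-- The variable numeral of literal `j` of a genuine clause code. [folklore] -/
theorem varF_encode (C : Clause ℕ) {j : ℕ} (hj : j < C.length) :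
    varF j (encodingClause.encode C) = encodeNat (C[j]).1 := by
  rw [varF, Function.comp_apply, litItemF_encode C hj, encodeLit_eq, fstF_boolPair]

/-- The polarity string of literal `j` of a genuine clause code. [folklore] -/
theorem pltF_encode (C : Clause ℕ) {j : ℕ} (hj : j < C.length) :
    pltF j (encodingClause.encode C) = [(C[j]).2] := by
  rw [pltF, Function.comp_apply, litItemF_encode C hj, encodeLit_eq, sndF_boolPair]

/-- Fields are substrings: `|litItemF j a| ≤ |a|`. [folklore] -/
theorem length_litItemF_le (j : ℕ) (a : List Bool) : (litItemF j a).length ≤ a.length :=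
  (length_nthF_le j _).trans (Lemma3FP.length_sndF_le a)

/-- `|varF j a| ≤ |a|`. [folklore] -/
theorem length_varF_le (j : ℕ) (a : List Bool) : (varF j a).length ≤ a.length :=
  (Lemma3FP.length_fstF_le _).trans (length_litItemF_le j a)

/-! ### The first-occurrence fold: the step -/

/-- The state `⟨[flag], 1ᵏ⟩` of the scan (latched?, count). [folklore] -/
def stEnc (b : Bool) (k : ℕ) : List Bool := boolPair [b] (ones k)

/-- On a step record `⟨u, ⟨a, st⟩⟩` with context `u = ⟨x, L⟩`: the query numeral `x`.
[folklore] -/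
def qryF : List Bool → List Bool := fstF ∘ nthF 0

/-- On a step record: the clause code `a`. [folklore] -/
def itemF : List Bool → List Bool := nthF 1

/-- On a step record: the state. [folklore] -/
def stF : List Bool → List Bool := sndPow 1

/-- On a step record: the latch test "flag = [1]" (one-bit on every input). [folklore] -/
def flagF : List Bool → List Bool := eqPairFn ∘ fanoutFn (fstF ∘ stF) (fun _ => [true])

/-- On a step record: the count. [folklore] -/
def cntF : List Bool → List Bool := sndF ∘ stF

/-- On a step record: "the numeral of literal `j` of `a` is the query" (one-bit). [folklore] -/
def hitF (j : ℕ) : List Bool → List Bool := eqPairFn ∘ fanoutFn (varF j ∘ itemF) qryF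

/-- On a step record: the new state after scanning literal `j` — unchanged if latched, latched
at the same count on a hit, else the count bumped. [folklore] -/
def newStF (j : ℕ) : List Bool → List Bool :=
  iteFn flagF stF (iteFn (hitF j) (fanoutFn (fun _ => [true]) cntF)
    (fanoutFn (fun _ => [false]) (List.cons true ∘ cntF)))

/-- On a step record: the record with the state replaced by `newStF j`. [folklore] -/
def updF (j : ℕ) : List Bool → List Bool := fanoutFn (nthF 0) (fanoutFn itemF (newStF j))

/-- **The step of the first-occurrence fold**: scan the three literals of the clause code, return
the state. [folklore] -/
def occStep : List Bool → List Bool := stF ∘ updF 2 ∘ updF 1 ∘ updF 0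

/-- The model of one scan: latch at the count on a hit, else count. [folklore] -/
def occUpd (x : List Bool) (st : Bool × ℕ) (y : List Bool) : Bool × ℕ :=
  if st.1 then st else if y = x then (true, st.2) else (false, st.2 + 1)

/-- The model of the step: three scans. [folklore] -/
def occClause (x : List Bool) (st : Bool × ℕ) (a : List Bool) : Bool × ℕ :=
  occUpd x (occUpd x (occUpd x st (varF 0 a)) (varF 1 a)) (varF 2 a)

/-- Value of `flagF` on a genuine argument. [folklore] -/
theorem flagF_rec (u a : List Bool) (b : Bool) (k : ℕ) :
    flagF (boolPair u (boolPair a (stEnc b k))) = [b] := by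
  simp only [flagF, stF, stEnc, Function.comp_apply, fanoutFn_apply, sndPow_succ_boolPair,
    sndPow_zero_boolPair, fstF_boolPair, eqPairFn_boolPair]
  cases b <;> simp

/-- Value of `hitF` on a genuine argument. [folklore] -/
theorem hitF_rec (j : ℕ) (u a : List Bool) (b : Bool) (k : ℕ) :
    hitF j (boolPair u (boolPair a (stEnc b k))) = [decide (varF j a = fstF u)] := by
  simp only [hitF, itemF, qryF, Function.comp_apply, fanoutFn_apply, nthF_succ_boolPair,
    nthF_zero_boolPair, eqPairFn_boolPair]

/-- Value of `cntF` on a genuine argument. [folklore] -/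
theorem cntF_rec (u a : List Bool) (b : Bool) (k : ℕ) :
    cntF (boolPair u (boolPair a (stEnc b k))) = ones k := by
  simp [cntF, stF, stEnc]

/-- Value of `newStF j` on a step record. [folklore] -/
theorem newStF_rec (j : ℕ) (u a : List Bool) (b : Bool) (k : ℕ) :
    newStF j (boolPair u (boolPair a (stEnc b k))) =
      stEnc (occUpd (fstF u) (b, k) (varF j a)).1 (occUpd (fstF u) (b, k) (varF j a)).2 := by
  rw [newStF, iteFn_apply (flagF_rec u a b k)]
  cases b
  · rw [if_neg Bool.false_ne_true, iteFn_apply (hitF_rec j u a false k)]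
    by_cases h : varF j a = fstF u
    · rw [decide_eq_true h, if_pos rfl, fanoutFn_apply, cntF_rec]
      simp [occUpd, h, stEnc]
    · rw [decide_eq_false h, if_neg Bool.false_ne_true, fanoutFn_apply, Function.comp_apply, cntF_rec]
      simp [occUpd, h, stEnc, List.replicate_succ]
  · rw [if_pos rfl]
    simp [stF, occUpd, stEnc]

/-- Value of `updF j` on a step record. [folklore] -/
theorem updF_rec (j : ℕ) (u a : List Bool) (b : Bool) (k : ℕ) :
    updF j (boolPair u (boolPair a (stEnc b k))) =
      boolPair u (boolPair a (stEnc (occUpd (fstF u) (b, k) (varF j a)).1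
        (occUpd (fstF u) (b, k) (varF j a)).2)) := by
  rw [updF, fanoutFn_apply, fanoutFn_apply, newStF_rec]
  simp [itemF]

/-- **Value of the step** on a step record: the model `occClause`. [folklore] -/
theorem occStep_rec (u a : List Bool) (b : Bool) (k : ℕ) :
    occStep (boolPair u (boolPair a (stEnc b k))) =
      stEnc (occClause (fstF u) (b, k) a).1 (occClause (fstF u) (b, k) a).2 := by
  simp only [occStep, Function.comp_apply, updF_rec, occClause, Prod.mk.eta, stF,
    sndPow_succ_boolPair, sndPow_zero_boolPair]

/-! ### The first-occurrence fold: growth and membership in `FP` -/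

/-- One-bit: the latch test. [folklore] -/
theorem oneBit_flagF : OneBit flagF := oneBit_eqPairFn.comp _

/-- One-bit: the hit test. [folklore] -/
theorem oneBit_hitF (j : ℕ) : OneBit (hitF j) := oneBit_eqPairFn.comp _

/-- `newStF j ∈ FP`. [cite: AroraBarak2009, §1.3] -/
theorem newStF_mem_FP (j : ℕ) : newStF j ∈ FP :=
  iteFn_mem_FP (comp_mem_FP eqPairFn_mem_FP (fanoutFn_mem_FP (comp_mem_FP fstF_mem_FP (sndPow_mem_FP 1))
      (const_mem_FP _))) (sndPow_mem_FP 1)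
    (iteFn_mem_FP (comp_mem_FP eqPairFn_mem_FP (fanoutFn_mem_FP (comp_mem_FP (varF_mem_FP j) (nthF_mem_FP 1))
        (comp_mem_FP fstF_mem_FP (nthF_mem_FP 0))))
      (fanoutFn_mem_FP (const_mem_FP _) (comp_mem_FP sndF_mem_FP (sndPow_mem_FP 1)))
      (fanoutFn_mem_FP (const_mem_FP _) (comp_mem_FP (cons_mem_FP true)
        (comp_mem_FP sndF_mem_FP (sndPow_mem_FP 1)))))

/-- `updF j ∈ FP`. [cite: AroraBarak2009, §1.3] -/
theorem updF_mem_FP (j : ℕ) : updF j ∈ FP :=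
  fanoutFn_mem_FP (nthF_mem_FP 0) (fanoutFn_mem_FP (nthF_mem_FP 1) (newStF_mem_FP j))

/-- **`occStep ∈ FP`.** [cite: AroraBarak2009, §1.3] -/
theorem occStep_mem_FP : occStep ∈ FP :=
  comp_mem_FP (sndPow_mem_FP 1) (comp_mem_FP (updF_mem_FP 2) (comp_mem_FP (updF_mem_FP 1) (updF_mem_FP 0)))

/-- Total growth of the new state: `|newStF j r| ≤ |sndPow 1 r| + 5`. [folklore] -/
theorem length_newStF_le (j : ℕ) (r : List Bool) : (newStF j r).length ≤ (sndPow 1 r).length + 5 := by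
  have hc : (cntF r).length ≤ (sndPow 1 r).length := by
    simp only [cntF, stF, Function.comp_apply]; exact Lemma3FP.length_sndF_le _
  rw [newStF, iteFn_of_oneBit oneBit_flagF]
  split_ifs
  · simp [stF]
  · rw [iteFn_of_oneBit (oneBit_hitF j)]
    split_ifs
    · rw [length_fanoutFn]; simp only [List.length_cons, List.length_nil]; omega
    · rw [length_fanoutFn]; simp only [List.length_cons, List.length_nil, Function.comp_apply]; omega

/-- Total growth of one update: the state grows by at most `5`, the other fields are kept.
[folklore] -/
theorem updF_total (j : ℕ) (r : List Bool) :
    updF j r = boolPair (nthF 0 r) (boolPair (nthF 1 r) (newStF j r)) := by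
  simp [updF, itemF]

/-- **`FoldGrowth 15 occStep`**: the step returns a state at most `15` symbols longer than the
incoming one, on every input. [folklore] -/
theorem foldGrowth_occStep : FoldGrowth 15 occStep := by
  intro r
  have h0 := length_newStF_le 0 r
  set r1 := updF 0 r with hr1
  have e1 : r1 = boolPair (nthF 0 r) (boolPair (nthF 1 r) (newStF 0 r)) := updF_total 0 r
  have h1 := length_newStF_le 1 r1
  have s1 : sndPow 1 r1 = newStF 0 r := by rw [e1]; simp
  set r2 := updF 1 r1 with hr2
  have e2 : r2 = boolPair (nthF 0 r1) (boolPair (nthF 1 r1) (newStF 1 r1)) := updF_total 1 r1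
  have h2 := length_newStF_le 2 r2
  have s2 : sndPow 1 r2 = newStF 1 r1 := by rw [e2]; simp
  have e3 : occStep r = newStF 2 r2 := by
    simp only [occStep, Function.comp_apply, ← hr1, ← hr2, updF_total 2 r2, stF, sndPow_succ_boolPair,
      sndPow_zero_boolPair]
  rw [e3]
  rw [s2] at h2; rw [s1] at h1
  have : (sndPow 1 r).length = (sndF (sndF r)).length := rfl
  omega

/-! ### The first-occurrence fold: the brick and its value -/

/-- The initial state: not latched, count `0`. [folklore] -/
def occIni : List Bool → List Bool := fun _ => stEnc false 0

/-- The fold over the clause codes, on `⟨x, L⟩` (query numeral, list code). [folklore] -/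
def occFoldF : List Bool → List Bool := foldFn occStep occIni

/-- **The first-occurrence brick**: `⟨w, x⟩ ↦ 1^{count}`, the count of the scan of the clause
codes of `w` for the numeral `x`. [folklore] -/
def firstOccF : List Bool → List Bool := sndF ∘ occFoldF ∘ fanoutFn sndF (sndF ∘ fstF)

/-- `occFoldF ∈ FP`. [cite: AroraBarak2009, §1.3 (bounded loops)] -/
theorem occFoldF_mem_FP : occFoldF ∈ FP := foldFn_mem_FP occStep_mem_FP (const_mem_FP _) foldGrowth_occStep

/-- **`firstOccF ∈ FP`.** [cite: AroraBarak2009, §1.3] -/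
theorem firstOccF_mem_FP : firstOccF ∈ FP :=
  comp_mem_FP sndF_mem_FP (comp_mem_FP occFoldF_mem_FP (fanoutFn_mem_FP sndF_mem_FP
    (comp_mem_FP sndF_mem_FP fstF_mem_FP)))

/-- The fold of the step is the fold of the model. [folklore] -/
theorem foldl_occStep (u : List Bool) : ∀ (l : List (List Bool)) (b : Bool) (k : ℕ),
    l.foldl (fun acc a => occStep (boolPair u (boolPair a acc))) (stEnc b k) =
      stEnc (l.foldl (occClause (fstF u)) (b, k)).1 (l.foldl (occClause (fstF u)) (b, k)).2
  | [], b, k => rfl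
  | a :: l, b, k => by
    rw [List.foldl_cons, List.foldl_cons, occStep_rec, foldl_occStep u l]

/-- **Value of the fold** on `⟨x, L⟩`: the model folded over the items of `L`. [folklore] -/
theorem occFoldF_boolPair (x L : List Bool) :
    occFoldF (boolPair x L) =
      stEnc ((decNil L).foldl (occClause x) (false, 0)).1 ((decNil L).foldl (occClause x) (false, 0)).2 := by
  rw [occFoldF, foldFn_boolPair, show occIni (boolPair x L) = stEnc false 0 from rfl, foldl_occStep,
    fstF_boolPair]

/-- A latched scan stays latched. [folklore] -/
theorem foldl_occUpd_true (x : List Bool) (k : ℕ) : ∀ l : List (List Bool),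
    l.foldl (occUpd x) (true, k) = (true, k)
  | [] => rfl
  | y :: l => by rw [List.foldl_cons, show occUpd x (true, k) y = (true, k) from rfl, foldl_occUpd_true x k l]

/-- **The scan over numerals finds the first occurrence**: from `(false, k)` over the numerals
of `l`, the scan for `bin v` ends latched iff `v ∈ l`, at count `k + l.idxOf v`. [folklore] -/
theorem foldl_occUpd_map (v k : ℕ) : ∀ l : List ℕ,
    (l.map encodeNat).foldl (occUpd (encodeNat v)) (false, k) = (decide (v ∈ l), k + l.idxOf v)
  | [] => by simp
  | y :: l => by
    rw [List.map_cons, List.foldl_cons]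
    by_cases h : y = v
    · subst h
      rw [show occUpd (encodeNat y) (false, k) (encodeNat y) = (true, k) by simp [occUpd],
        foldl_occUpd_true, List.idxOf_cons_self]
      simp
    · have hne : encodeNat y ≠ encodeNat v := fun e => h (by
        have := congrArg decodeNat e; rwa [decode_encodeNat, decode_encodeNat] at this)
      rw [show occUpd (encodeNat v) (false, k) (encodeNat y) = (false, k + 1) by simp [occUpd, hne],
        foldl_occUpd_map v (k + 1) l, List.idxOf_cons_ne _ h]
      have : (v ∈ y :: l) ↔ v ∈ l := by simp [Ne.symm h]
      simp only [this, Nat.succ_eq_add_one]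
      congr 1; omega

/-- The step on a genuine clause code of three literals scans its three numerals. [folklore] -/
theorem occClause_encode (x : List Bool) (st : Bool × ℕ) {C : Clause ℕ} (h3 : C.length = 3) :
    occClause x st (encodingClause.encode C) = ((C.map Prod.fst).map encodeNat).foldl (occUpd x) st := by
  obtain ⟨l0, l1, l2, rfl⟩ := List.length_eq_three.1 h3
  rw [occClause, varF_encode _ (by simp), varF_encode _ (by simp), varF_encode _ (by simp)]
  rfl

/-- The fold over genuine clause codes of three literals scans `varList`. [folklore] -/
theorem foldl_occClause_encode (x : List Bool) {φ : CNF ℕ} (hφ : φ.IsThreeLiteralClauses)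
    (st : Bool × ℕ) :
    (φ.map encodingClause.encode).foldl (occClause x) st = ((varList φ).map encodeNat).foldl (occUpd x) st := by
  induction φ generalizing st with
  | nil => rfl
  | cons C φ ih =>
    rw [List.map_cons, List.foldl_cons, occClause_encode x st (hφ C (by simp)).1,
      ih (fun C' hC' => hφ C' (List.mem_cons_of_mem _ hC')),
      show varList (C :: φ) = C.map Prod.fst ++ varList φ from rfl, List.map_append, List.foldl_append]

/-- **Value of the first-occurrence brick on a genuine argument**: `firstOccF ⟨encode φ, bin v⟩ =
1^{firstOcc φ v}` for clause lists with three literals per clause. [folklore] -/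
theorem firstOccF_encode {φ : CNF ℕ} (hφ : φ.IsThreeLiteralClauses) (v : ℕ) :
    firstOccF (boolPair (encodingCNF.encode φ) (encodeNat v)) = ones (firstOcc φ v) := by
  rw [firstOccF, Function.comp_apply, Function.comp_apply, fanoutFn_apply, sndF_boolPair,
    Function.comp_apply, fstF_boolPair, encodeCNF_eq, sndF_boolPair, occFoldF_boolPair, decNil_encList,
    foldl_occClause_encode _ hφ, foldl_occUpd_map, stEnc, sndF_boolPair, firstOcc, Nat.zero_add]

/-! ### The instance test -/

/-- On `⟨x, a⟩`: "the header of the clause code `a` is `1³`" (one-bit). [folklore] -/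
def lenThreeF : List Bool → List Bool := eqPairFn ∘ fanoutFn (fstF ∘ sndF) (fun _ => ones 3)

/-- On `⟨x, a⟩`: "literal codes `j` and `j'` of `a` coincide" (one-bit). [folklore] -/
def litEqF (j j' : ℕ) : List Bool → List Bool := eqPairFn ∘ fanoutFn (litItemF j ∘ sndF) (litItemF j' ∘ sndF)

/-- On `⟨x, a⟩`: **the clause test** — header `1³` and three pairwise distinct literal codes.
[cite: GareyJohnson1979, LO4 (p. 259)] -/
def clauseOKF : List Bool → List Bool :=
  andFn lenThreeF (andFn (notFn (litEqF 0 1)) (andFn (notFn (litEqF 0 2)) (notFn (litEqF 1 2))))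

/-- **The instance test** on a CNF code: every clause code passes the clause test. [folklore] -/
def threeOKF : List Bool → List Bool := allFn clauseOKF

/-- **The guard**: the input is a canonical CNF code and passes the instance test. [folklore] -/
def goodF : List Bool → List Bool := andFn KSATRed.isCanonFn threeOKF

/-- `lenThreeF` is one-bit on every input. [folklore] -/
theorem oneBit_lenThreeF : OneBit lenThreeF := oneBit_eqPairFn.comp _

/-- `litEqF` is one-bit on every input. [folklore] -/
theorem oneBit_litEqF (j j' : ℕ) : OneBit (litEqF j j') := oneBit_eqPairFn.comp _

/-- The clause test is one-bit. [folklore] -/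
theorem oneBit_clauseOKF : OneBit clauseOKF :=
  oneBit_andFn oneBit_lenThreeF (oneBit_andFn (oneBit_notFn (oneBit_litEqF 0 1))
    (oneBit_andFn (oneBit_notFn (oneBit_litEqF 0 2)) (oneBit_notFn (oneBit_litEqF 1 2))))

/-- The instance test is one-bit. [folklore] -/
theorem oneBit_threeOKF : OneBit threeOKF := oneBit_allFn oneBit_clauseOKF

/-- The guard is one-bit. [folklore] -/
theorem oneBit_goodF : OneBit goodF := oneBit_andFn KSATRed.oneBit_isCanonFn oneBit_threeOKF

/-- `lenThreeF`: membership in `FP` by composition. [cite: AroraBarak2009, §1.3] -/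
theorem lenThreeF_mem_FP : lenThreeF ∈ FP :=
  comp_mem_FP eqPairFn_mem_FP (fanoutFn_mem_FP (comp_mem_FP fstF_mem_FP sndF_mem_FP) (const_mem_FP _))

/-- `litEqF`: membership in `FP` by composition. [cite: AroraBarak2009, §1.3] -/
theorem litEqF_mem_FP (j j' : ℕ) : litEqF j j' ∈ FP :=
  comp_mem_FP eqPairFn_mem_FP (fanoutFn_mem_FP (comp_mem_FP (litItemF_mem_FP j) sndF_mem_FP)
    (comp_mem_FP (litItemF_mem_FP j') sndF_mem_FP))

/-- `clauseOKF ∈ FP`. [cite: AroraBarak2009, §1.3] -/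
theorem clauseOKF_mem_FP : clauseOKF ∈ FP :=
  andFn_mem_FP lenThreeF_mem_FP (andFn_mem_FP (notFn_mem_FP (litEqF_mem_FP 0 1))
    (andFn_mem_FP (notFn_mem_FP (litEqF_mem_FP 0 2)) (notFn_mem_FP (litEqF_mem_FP 1 2))))

/-- **`threeOKF ∈ FP`.** [cite: AroraBarak2009, §1.3] -/
theorem threeOKF_mem_FP : threeOKF ∈ FP := allFn_mem_FP clauseOKF_mem_FP oneBit_clauseOKF

/-- **`goodF ∈ FP`.** [cite: AroraBarak2009, §1.3] -/
theorem goodF_mem_FP : goodF ∈ FP := andFn_mem_FP KSATRed.isCanonFn_mem_FP threeOKF_mem_FP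

/-- A list of three entries is duplicate-free iff its entries are pairwise distinct. [folklore] -/
theorem nodup_three {α : Type*} [DecidableEq α] (a b c : α) :
    [a, b, c].Nodup ↔ a ≠ b ∧ a ≠ c ∧ b ≠ c := by
  simp [List.nodup_cons, not_or, and_assoc]

/-- **Value of the clause test** on `⟨x, encode C⟩`: `[|C| = 3 ∧ C.Nodup]`. [folklore] -/
theorem clauseOKF_boolPair (x : List Bool) (C : Clause ℕ) :
    clauseOKF (boolPair x (encodingClause.encode C)) = [decide (C.length = 3 ∧ C.Nodup)] := by
  have hlen : lenThreeF (boolPair x (encodingClause.encode C)) = [decide (C.length = 3)] := by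
    simp only [lenThreeF, Function.comp_apply, fanoutFn_apply, sndF_boolPair, encodeClause_eq, fstF_boolPair,
      eqPairFn_boolPair]
    congr 1
    apply Bool.decide_congr
    constructor
    · intro h; simpa using congrArg List.length h
    · intro h; rw [h]
  have heq : ∀ j j', litEqF j j' (boolPair x (encodingClause.encode C)) =
      [decide (litItemF j (encodingClause.encode C) = litItemF j' (encodingClause.encode C))] := by
    intro j j'
    simp only [litEqF, Function.comp_apply, fanoutFn_apply, sndF_boolPair, eqPairFn_boolPair]
  rw [clauseOKF, andFn_apply hlen (andFn_apply (notFn_apply (heq 0 1)) (andFn_apply (notFn_apply (heq 0 2))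
    (notFn_apply (heq 1 2))))]
  by_cases h3 : C.length = 3
  · obtain ⟨l0, l1, l2, rfl⟩ := List.length_eq_three.1 h3
    have hinj := encodingLiteral.encode_injective
    rw [litItemF_encode _ (by simp), litItemF_encode _ (by simp), litItemF_encode _ (by simp),
      decide_eq_true h3]
    simp only [List.getElem_cons_zero, List.getElem_cons_succ, hinj.eq_iff, nodup_three, ne_eq]
    cases h01 : decide (l0 = l1) <;> cases h02 : decide (l0 = l2) <;> cases h12 : decide (l1 = l2) <;>
      simp_all
  · rw [decide_eq_false h3]
    simp [h3]

/-- `IsThreeLiteralClauses` is decidable. [folklore] -/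
instance (φ : CNF ℕ) : Decidable φ.IsThreeLiteralClauses := by
  unfold CNF.IsThreeLiteralClauses; infer_instance

/-- **Value of the instance test on a CNF code**: `[φ.IsThreeLiteralClauses]`. [folklore] -/
theorem threeOKF_encode (φ : CNF ℕ) :
    threeOKF (encodingCNF.encode φ) = [decide φ.IsThreeLiteralClauses] := by
  rw [threeOKF, encodeCNF_eq, allFn_boolPair oneBit_clauseOKF, decNil_encList]
  congr 1
  apply Bool.decide_congr
  simp only [List.mem_map, forall_exists_index, and_imp, forall_apply_eq_imp_iff₂, clauseOKF_boolPair,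
    List.cons.injEq, and_true, decide_eq_true_eq]
  rfl

/-- **Value of the guard on a CNF code**: `[φ.IsThreeLiteralClauses]`. [folklore] -/
theorem goodF_encode (φ : CNF ℕ) : goodF (encodingCNF.encode φ) = [decide φ.IsThreeLiteralClauses] := by
  have hc : KSATRed.isCanonFn (encodingCNF.encode φ) = [true] := by
    rw [KSATRed.isCanonFn_apply, KSATRed.decCNF_encode]; simp
  rw [goodF, andFn_apply hc (threeOKF_encode φ), Bool.true_and]

/-- **Value of the guard on a non-code**: `[0]`. [folklore] -/
theorem goodF_of_not_canon {x : List Bool} (hx : encodingCNF.encode (NegCNF.decCNF x) ≠ x) : goodF x = [false] := by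
  have hc : KSATRed.isCanonFn x = [false] := by rw [KSATRed.isCanonFn_apply]; simp [hx]
  obtain ⟨b, hb⟩ := oneBit_threeOKF x
  rw [goodF, andFn_apply hc hb, Bool.false_and]

/-! ### The complementary-pair test on a clause code -/

/-- "Literals `j`, `j'` have the same numeral" (one-bit). [folklore] -/
def varEqF (j j' : ℕ) : List Bool → List Bool := eqPairFn ∘ fanoutFn (varF j) (varF j')

/-- "Literals `j`, `j'` have the same polarity" (one-bit). [folklore] -/
def polEqF (j j' : ℕ) : List Bool → List Bool := eqPairFn ∘ fanoutFn (pltF j) (pltF j')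

/-- "Literals `j`, `j'` are complementary" (one-bit). [folklore] -/
def pairAtF (j j' : ℕ) : List Bool → List Bool := andFn (varEqF j j') (notFn (polEqF j j'))

/-- **The complementary-pair test** on a clause code: some two of its three literals are
complementary. [folklore] -/
def hasPairF : List Bool → List Bool := orFn (pairAtF 0 1) (orFn (pairAtF 0 2) (pairAtF 1 2))

/-- `pairAtF` is one-bit on every input. [folklore] -/
theorem oneBit_pairAtF (j j' : ℕ) : OneBit (pairAtF j j') :=
  oneBit_andFn (oneBit_eqPairFn.comp _) (oneBit_notFn (oneBit_eqPairFn.comp _))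

/-- The pair test is one-bit. [folklore] -/
theorem oneBit_hasPairF : OneBit hasPairF :=
  oneBit_orFn (oneBit_pairAtF 0 1) (oneBit_orFn (oneBit_pairAtF 0 2) (oneBit_pairAtF 1 2))

/-- `pairAtF`: membership in `FP` by composition. [cite: AroraBarak2009, §1.3] -/
theorem pairAtF_mem_FP (j j' : ℕ) : pairAtF j j' ∈ FP :=
  andFn_mem_FP (comp_mem_FP eqPairFn_mem_FP (fanoutFn_mem_FP (varF_mem_FP j) (varF_mem_FP j')))
    (notFn_mem_FP (comp_mem_FP eqPairFn_mem_FP (fanoutFn_mem_FP (pltF_mem_FP j) (pltF_mem_FP j'))))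

/-- **`hasPairF ∈ FP`.** [cite: AroraBarak2009, §1.3] -/
theorem hasPairF_mem_FP : hasPairF ∈ FP :=
  orFn_mem_FP (pairAtF_mem_FP 0 1) (orFn_mem_FP (pairAtF_mem_FP 0 2) (pairAtF_mem_FP 1 2))

/-- Value of `pairAtF` on a genuine clause code. [folklore] -/
theorem pairAtF_encode (C : Clause ℕ) {j j' : ℕ} (hj : j < C.length) (hj' : j' < C.length) :
    pairAtF j j' (encodingClause.encode C) = [decide ((C[j]).1 = (C[j']).1 ∧ (C[j]).2 ≠ (C[j']).2)] := by
  have hv : varEqF j j' (encodingClause.encode C) = [decide ((C[j]).1 = (C[j']).1)] := by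
    simp only [varEqF, Function.comp_apply, fanoutFn_apply, varF_encode C hj, varF_encode C hj',
      eqPairFn_boolPair]
    congr 1
    apply Bool.decide_congr
    constructor
    · intro h; have := congrArg decodeNat h; rwa [decode_encodeNat, decode_encodeNat] at this
    · intro h; rw [h]
  have hp : polEqF j j' (encodingClause.encode C) = [decide ((C[j]).2 = (C[j']).2)] := by
    simp only [polEqF, Function.comp_apply, fanoutFn_apply, pltF_encode C hj, pltF_encode C hj',
      eqPairFn_boolPair, List.cons.injEq, and_true]
  rw [pairAtF, andFn_apply hv (notFn_apply hp)]
  by_cases h1 : (C[j]).1 = (C[j']).1 <;> by_cases h2 : (C[j]).2 = (C[j']).2 <;> simp [h1, h2]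

/-- Two literals are complementary iff they share the variable and differ in polarity.
[folklore] -/
theorem negate_eq_iff (ℓ ℓ' : Literal ℕ) : ℓ.negate = ℓ' ↔ ℓ.1 = ℓ'.1 ∧ ℓ.2 ≠ ℓ'.2 := by
  obtain ⟨v, b⟩ := ℓ; obtain ⟨v', b'⟩ := ℓ'
  simp only [Literal.negate, Prod.mk.injEq, ne_eq]
  cases b <;> cases b' <;> simp

/-- Complementarity is symmetric. [folklore] -/
theorem negate_eq_comm (ℓ ℓ' : Literal ℕ) : ℓ.negate = ℓ' ↔ ℓ'.negate = ℓ := by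
  constructor <;> rintro rfl <;> exact negate_negate _

/-- No literal is its own complement. [folklore] -/
theorem negate_ne_self (ℓ : Literal ℕ) : ℓ.negate ≠ ℓ := fun h => by
  have := congrArg Prod.snd h; cases ℓ; simp [Literal.negate] at this

/-- **Value of the pair test on a genuine clause code of three literals**: `[HasPair C]`.
[folklore] -/
theorem hasPairF_encode {C : Clause ℕ} (h3 : C.length = 3) :
    hasPairF (encodingClause.encode C) = [decide (HasPair C)] := by
  obtain ⟨l0, l1, l2, rfl⟩ := List.length_eq_three.1 h3
  rw [hasPairF, orFn_apply (pairAtF_encode _ (by simp) (by simp)) (orFn_apply (pairAtF_encode _ (by simp) (by simp))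
    (pairAtF_encode _ (by simp) (by simp)))]
  simp only [List.getElem_cons_zero, List.getElem_cons_succ, ← negate_eq_iff]
  congr 1
  rw [Bool.eq_iff_iff]
  simp only [Bool.or_eq_true, decide_eq_true_eq, HasPair, List.mem_cons, List.not_mem_nil, or_false]
  constructor
  · rintro (h | h | h)
    · exact ⟨l0, Or.inl rfl, Or.inr (Or.inl h)⟩
    · exact ⟨l0, Or.inl rfl, Or.inr (Or.inr h)⟩
    · exact ⟨l1, Or.inr (Or.inl rfl), Or.inr (Or.inr h)⟩
  · rintro ⟨ℓ, hℓ, hn⟩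
    rcases hℓ with rfl | rfl | rfl <;> rcases hn with h | h | h
    · exact absurd h (negate_ne_self _)
    · exact Or.inl h
    · exact Or.inr (Or.inl h)
    · exact Or.inl ((negate_eq_comm _ _).1 h)
    · exact absurd h (negate_ne_self _)
    · exact Or.inr (Or.inr h)
    · exact Or.inr (Or.inl ((negate_eq_comm _ _).1 h))
    · exact Or.inr (Or.inr ((negate_eq_comm _ _).1 h))
    · exact absurd h (negate_ne_self _)

end OneInThree

end Literature.Computability.Complexity
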